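import Summits.AtomisticToContinuum.BoseEinsteinCondensation.Theorems.BECInfraredBoundAssembly
import Summits.AtomisticToContinuum.BoseEinsteinCondensation.Theorems.BECDyadicChainingZeroModeOfChaining
import Summits.AtomisticToContinuum.BoseEinsteinCondensation.Theses.BECDyadicChaining

/-!
# Route `BECDyadicChaining`, assembly item `Assembly` (stmt-AtomisticToContinuum-13196)

Settles the assembly item `stmt-AtomisticToContinuum-13196` of route
`route-AtomisticToContinuum-BECDyadicChaining`: the implication

  `DyadicCoherenceDefect → BaseCoherentMass → BoseEinsteinCondensation`

(the audited sub-problem abbrev `_root_.BoseEinsteinCondensation`, by name).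

The hypotheses of `Assembly` are, verbatim and in the same order, those of the route's deciding
theorem `closes`, so the assembly is that composition: the landed glue item `ZeroModeOfChaining`
(`Theorems.zeroModeOfChaining_proof`, file `Theorems/BECDyadicChainingZeroModeOfChaining.lean`:
the telescoping chain `√N ≤ 2 A_K ≤ 2 A_0 + √N/2`, hence `⟨φ₀, γ_Ψ φ₀⟩ = A_0² ≥ N/16`) takes the two
ranked cruxes `DyadicCoherenceDefect`, `BaseCoherentMass` to the shared zero-mode target
`ZeroModeOccupation` (X_B1, stmt-AtomisticToContinuum-0686: flat-mode occupation `≥ c N` for all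
`δ`-near-minimisers at small density), and the tree theorem
`AtomisticToContinuum.BECInfraredBound.bec_of_zeroMode` (proved in
`Theorems/BECInfraredBoundAssembly.lean`) takes X_B1 to the conjunct.
Pure logic; no analytic content lives here — the composition is spelled out (rather than citing
`closes`) so that this file depends only on the item statements and proved tree theorems.

References: [LSSY2005, §1.2 and Ch. 5] (the conjunct being assembled), [PenroseOnsager1956]
(the one-mode occupation criterion behind X_B1).
-/

namespace Summit.AtomisticToContinuum.BoseEinsteinCondensation.Theorems

/-- **Item stmt-AtomisticToContinuum-13196** (`Assembly` of route `BECDyadicChaining`, exact route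
decl): given `hD : DyadicCoherenceDefect` and `hB : BaseCoherentMass`, the landed glue
`zeroModeOfChaining_proof hD hB` is the zero-mode occupation thesis `ZeroModeOccupation` (X_B1 with
`c = 1/16`), which the proved tree theorem `AtomisticToContinuum.BECInfraredBound.bec_of_zeroMode`
turns into `BoseEinsteinCondensation`. Pure composition of the route's hypotheses (the route's
deciding theorem `closes`, curried). [folklore] -/
theorem becDyadicChaining_assembly_proof :
    Summit.AtomisticToContinuum.BoseEinsteinCondensation.Theses.BECDyadicChaining.Assembly := by
  unfold Theses.BECDyadicChaining.Assembly
  intro hD hB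
  exact _root_.AtomisticToContinuum.BECInfraredBound.bec_of_zeroMode (zeroModeOfChaining_proof hD hB)

end Summit.AtomisticToContinuum.BoseEinsteinCondensation.Theorems
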